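import Mathlib
import Summits.PneNP.PneNP.Theorems.OverlapGapAlgebraSearchHardWindowAffineRungTightnessCount

/-!
# PneNP / OverlapGapAlgebra — `SearchHardWindow`: tightness of the ALGEBRAIC rung (2/2) —
# sign-affine maps SUCCEED at low density (the copy rule)

Support (calibration) for the algebraic rung of crux `stmt-PneNP-2460`. With
`…AffineRungTightnessCount` (few skeletons lack a system of distinct representatives when
`e²α ≤ 1/2`):

* `shwAffT_exists_copyRule` — THE COPY RULE: a sign-affine search map (ternary-xor preserving in
  the polarities for every fixed skeleton — the class of `shwAff_successCount_le`) that satisfies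
  EVERY instance whose skeleton admits an SDR: each representative variable copies the polarity of
  its own occurrence;
* `shwAff_lowDensity_signAffine_succeeds` — finite form: for `k ≥ 2`, `e²α ≤ 1/2`, `n ≥ 1`,
  `m ≤ αn`, the copy rule solves at least a `(1 - 2/n)`-fraction of `F_k(n, m)`;
* `shwAff_lowDensity_eventually` — asymptotic form: eventually a `(1 - ε)`-fraction of
  `F_k(n, ⌊αn⌋)`.
So the density threshold of the algebraic (sign-affine) class lies between `1/(2e²) ≈ 0.068` and
`1` (`shwAff_affineMapsFail`): far below every clustering / overlap-gap scale `2^k log k / k`, and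
bounded away from `0` uniformly in `k` — the class is a genuine algorithm family, and its failure
in the window is not an artefact of triviality.
No definitions; axioms `propext`, `Classical.choice`, `Quot.sound`.
-/

set_option linter.dupNamespace false -- `Summit.PneNP.PneNP.…`: summit = sub-problem (D-0017)

namespace Summit.PneNP.PneNP.Theorems

open Finset
open scoped Classical

section CopyRule

variable {m k n : ℕ}

/-- **The copy rule.** There is a sign-affine search map which satisfies every instance whose
variable skeleton admits a system of distinct representatives (an injective choice of one
variable per clause): set each representative so as to satisfy its own occurrence. -/
theorem shwAffT_exists_copyRule :
    ∃ g : (Fin m → Fin k → Fin n × Bool) → (Fin n → Bool),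
      (∀ (S : Fin m → Fin k → Fin n) (x y z : Fin m → Fin k → Bool) (v : Fin n),
        g (fun i j => (S i j, (x i j ^^ y i j) ^^ z i j)) v =
          ((g (fun i j => (S i j, x i j)) v ^^ g (fun i j => (S i j, y i j)) v) ^^
            g (fun i j => (S i j, z i j)) v)) ∧
      ∀ Φ : Fin m → Fin k → Fin n × Bool,
        (∃ f : Fin m → Fin n, Function.Injective f ∧ ∀ i, ∃ j, (Φ i j).1 = f i) →
        ∀ i, ∃ j, g Φ (Φ i j).1 = (Φ i j).2 := by
  -- the rule, as a function of the skeleton and of the signs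
  let G : (Fin m → Fin k → Fin n) → (Fin m → Fin k → Bool) → Fin n → Bool := fun S b v =>
    if h : ∃ f : Fin m → Fin n, Function.Injective f ∧ ∀ i, ∃ j, S i j = f i then
      (if hv : ∃ i, Classical.choose h i = v then
        b (Classical.choose hv)
          (Classical.choose ((Classical.choose_spec h).2 (Classical.choose hv)))
      else false)
    else false
  refine ⟨fun Φ => G (fun i j => (Φ i j).1) (fun i j => (Φ i j).2), ?_, ?_⟩
  · intro S x y z v
    show G S (fun i j => (x i j ^^ y i j) ^^ z i j) v =
      ((G S x v ^^ G S y v) ^^ G S z v)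
    simp only [G]
    by_cases h : ∃ f : Fin m → Fin n, Function.Injective f ∧ ∀ i, ∃ j, S i j = f i
    · rw [dif_pos h, dif_pos h, dif_pos h, dif_pos h]
      by_cases hv : ∃ i, Classical.choose h i = v
      · rw [dif_pos hv, dif_pos hv, dif_pos hv, dif_pos hv]
      · rw [dif_neg hv, dif_neg hv, dif_neg hv, dif_neg hv]
        rfl
    · rw [dif_neg h, dif_neg h, dif_neg h, dif_neg h]
      rfl
  · intro Φ hΦ i
    set S : Fin m → Fin k → Fin n := fun i j => (Φ i j).1 with hS
    set b : Fin m → Fin k → Bool := fun i j => (Φ i j).2 with hb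
    have h : ∃ f : Fin m → Fin n, Function.Injective f ∧ ∀ i, ∃ j, S i j = f i := hΦ
    set f := Classical.choose h with hf
    have hfspec := Classical.choose_spec h
    -- the designated occurrence of clause `i`
    set j₀ := Classical.choose (hfspec.2 i) with hj₀
    have hj₀spec : S i j₀ = f i := Classical.choose_spec (hfspec.2 i)
    refine ⟨j₀, ?_⟩
    show G S b (S i j₀) = b i j₀
    simp only [G]
    rw [dif_pos h]
    have hv : ∃ i', Classical.choose h i' = S i j₀ := ⟨i, hj₀spec.symm⟩
    rw [dif_pos hv]
    have hi' : Classical.choose hv = i := by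
      apply hfspec.1
      have := Classical.choose_spec hv
      rw [this, hj₀spec]
    -- rewrite the chosen clause index to `i`
    have key : ∀ i' (hi : i' = i), b i' (Classical.choose ((Classical.choose_spec h).2 i')) = b i j₀ := by
      intro i' hi
      subst hi
      rfl
    exact key _ hi'

end CopyRule


section LowDensity

variable {m k n : ℕ}

/-- **Sign-affine maps SUCCEED at low density (tightness of the algebraic rung, finite form).** For
`k ≥ 2`, `e²α ≤ 1/2`, `n ≥ 1` and `m ≤ α n`, some sign-affine search map (the copy rule) solves at
least a `(1 - 2/n)`-fraction of the instances of `F_k(n, m)`. Together with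
`shwAff_successCount_le` (`≤ (1-2^{-k})^{m-n}`, exponentially small for `m ≥ (1+δ) n`) this pins
the density threshold of the algebraic class between `1/(2e²)` and `1`. -/
theorem shwAff_lowDensity_signAffine_succeeds (hk : 2 ≤ k) {α : ℝ} (hα : 0 ≤ α)
    (hαe : Real.exp 2 * α ≤ 1 / 2) (hn : 1 ≤ n) (hm : (m : ℝ) ≤ α * n) :
    ∃ g : (Fin m → Fin k → Fin n × Bool) → (Fin n → Bool),
      (∀ (S : Fin m → Fin k → Fin n) (x y z : Fin m → Fin k → Bool) (v : Fin n),
        g (fun i j => (S i j, (x i j ^^ y i j) ^^ z i j)) v =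
          ((g (fun i j => (S i j, x i j)) v ^^ g (fun i j => (S i j, y i j)) v) ^^
            g (fun i j => (S i j, z i j)) v)) ∧
      (1 - 2 / n) * Fintype.card (Fin m → Fin k → Fin n × Bool) ≤
        (((univ : Finset (Fin m → Fin k → Fin n × Bool)).filter fun Φ =>
          ∀ i, ∃ j, g Φ (Φ i j).1 = (Φ i j).2).card : ℝ) := by
  obtain ⟨g, hg, hsucc⟩ := shwAffT_exists_copyRule (m := m) (k := k) (n := n)
  refine ⟨g, hg, ?_⟩
  have hn0 : (0 : ℝ) < n := by exact_mod_cast hn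
  -- instances whose skeleton has no SDR
  set Bad : Finset (Fin m → Fin k → Fin n × Bool) := univ.filter fun Φ =>
    ¬ ∃ f : Fin m → Fin n, Function.Injective f ∧ ∀ i, ∃ j, (Φ i j).1 = f i with hBad
  set BadS : Finset (Fin m → Fin k → Fin n) := univ.filter fun S =>
    ¬ ∃ f : Fin m → Fin n, Function.Injective f ∧ ∀ i, ∃ j, S i j = f i with hBadS
  -- skeleton × signs ≃ instances
  let e : (Fin m → Fin k → Fin n) × (Fin m → Fin k → Bool) ≃ (Fin m → Fin k → Fin n × Bool) :=
    { toFun := fun p i j => (p.1 i j, p.2 i j)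
      invFun := fun Φ => (fun i j => (Φ i j).1, fun i j => (Φ i j).2)
      left_inv := fun p => rfl
      right_inv := fun Φ => rfl }
  have hBadcard : Bad.card = BadS.card * Fintype.card (Fin m → Fin k → Bool) := by
    rw [← card_univ (α := Fin m → Fin k → Bool), ← Finset.card_product]
    symm
    refine Finset.card_equiv e fun p => ?_
    simp only [hBad, hBadS, mem_product, mem_filter, mem_univ, true_and, and_true]
    rfl
  have hInst : (Fintype.card (Fin m → Fin k → Fin n × Bool) : ℝ) =
      (n : ℝ) ^ (k * m) * Fintype.card (Fin m → Fin k → Bool) := by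
    rw [← Fintype.card_congr e, Fintype.card_prod, Fintype.card_fun, Fintype.card_fun,
      Fintype.card_fin, Fintype.card_fin, Fintype.card_fin, ← pow_mul]
    push_cast
    ring
  -- `#Bad ≤ (2/n) #Inst`
  have hBadle : (Bad.card : ℝ) ≤ 2 / n * Fintype.card (Fin m → Fin k → Fin n × Bool) := by
    rcases Nat.eq_zero_or_pos m with hm0 | hmpos
    · -- no clauses: every skeleton has the empty SDR
      subst hm0
      have : Bad = ∅ := by
        rw [hBad, Finset.filter_eq_empty_iff]
        intro Φ _ h
        exact h ⟨Fin.elim0, fun i => Fin.elim0 i, fun i => Fin.elim0 i⟩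
      rw [this, card_empty]
      push_cast
      positivity
    · have hkm : 1 ≤ k * m := le_trans hmpos (Nat.le_mul_of_pos_left m (by omega))
      have hS := shwAffT_card_noSDR_le_real (m := m) (k := k) (n := n) hk hα hαe hm
      rw [hBadcard, hInst]
      push_cast
      have hCb : (0 : ℝ) ≤ Fintype.card (Fin m → Fin k → Bool) := Nat.cast_nonneg _
      have hpow : (n : ℝ) ^ (k * m) = (n : ℝ) ^ (k * m - 1) * n := by
        rw [← pow_succ, Nat.sub_add_cancel hkm]
      calc (BadS.card : ℝ) * Fintype.card (Fin m → Fin k → Bool)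
          ≤ 2 * (n : ℝ) ^ (k * m - 1) * Fintype.card (Fin m → Fin k → Bool) :=
            mul_le_mul_of_nonneg_right hS hCb
        _ = 2 / n * ((n : ℝ) ^ (k * m) * Fintype.card (Fin m → Fin k → Bool)) := by
            rw [hpow]
            field_simp
  -- `#success ≥ #Inst - #Bad`
  have hgood : (univ \ Bad) ⊆ (univ : Finset (Fin m → Fin k → Fin n × Bool)).filter fun Φ =>
      ∀ i, ∃ j, g Φ (Φ i j).1 = (Φ i j).2 := by
    intro Φ hΦ
    rw [mem_sdiff] at hΦ
    simp only [hBad, mem_filter, mem_univ, true_and, not_not] at hΦ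
    simp only [mem_filter, mem_univ, true_and]
    exact hsucc Φ hΦ
  have hcard := card_le_card hgood
  rw [card_univ_sdiff] at hcard
  have hBadle' : Bad.card ≤ Fintype.card (Fin m → Fin k → Fin n × Bool) := by
    simpa using Bad.card_le_univ
  have hR : ((Fintype.card (Fin m → Fin k → Fin n × Bool) - Bad.card : ℕ) : ℝ) ≤
      (((univ : Finset (Fin m → Fin k → Fin n × Bool)).filter fun Φ =>
        ∀ i, ∃ j, g Φ (Φ i j).1 = (Φ i j).2).card : ℝ) := by
    exact_mod_cast hcard
  rw [Nat.cast_sub hBadle'] at hR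
  have : (1 - 2 / n) * (Fintype.card (Fin m → Fin k → Fin n × Bool) : ℝ) =
      Fintype.card (Fin m → Fin k → Fin n × Bool) - 2 / n * Fintype.card (Fin m → Fin k → Fin n × Bool) := by
    ring
  linarith

/-- **Sign-affine maps succeed at low density (asymptotic form).** For `k ≥ 2` and `e²α ≤ 1/2`:
for every `ε > 0`, eventually in `n`, some sign-affine search map solves at least a
`(1 - ε)`-fraction of `F_k(n, ⌊α n⌋)`. (For `α > 1` every sign-affine map solves at most an
`ε`-fraction: `shwAff_affineMapsFail`.) -/
theorem shwAff_lowDensity_eventually (k : ℕ) (hk : 2 ≤ k) {α : ℝ} (hα : 0 ≤ α)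
    (hαe : Real.exp 2 * α ≤ 1 / 2) (ε : ℝ) (hε : 0 < ε) :
    ∀ᶠ n : ℕ in Filter.atTop, ∀ m : ℕ, m = ⌊α * n⌋₊ →
      ∃ g : (Fin m → Fin k → Fin n × Bool) → (Fin n → Bool),
        (∀ (S : Fin m → Fin k → Fin n) (x y z : Fin m → Fin k → Bool) (v : Fin n),
          g (fun i j => (S i j, (x i j ^^ y i j) ^^ z i j)) v =
            ((g (fun i j => (S i j, x i j)) v ^^ g (fun i j => (S i j, y i j)) v) ^^
              g (fun i j => (S i j, z i j)) v)) ∧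
        (1 - ε) * Fintype.card (Fin m → Fin k → Fin n × Bool) ≤
          (((univ : Finset (Fin m → Fin k → Fin n × Bool)).filter fun Φ =>
            ∀ i, ∃ j, g Φ (Φ i j).1 = (Φ i j).2).card : ℝ) := by
  filter_upwards [Filter.eventually_ge_atTop (⌈2 / ε⌉₊ + 1)] with n hn m hm
  have hn1 : 1 ≤ n := le_trans (by omega) hn
  have hn0 : (0 : ℝ) < n := by exact_mod_cast hn1
  have hm' : (m : ℝ) ≤ α * n := by
    rw [hm]
    exact Nat.floor_le (by positivity)
  obtain ⟨g, hg, hle⟩ := shwAff_lowDensity_signAffine_succeeds (m := m) hk hα hαe hn1 hm'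
  refine ⟨g, hg, le_trans ?_ hle⟩
  apply mul_le_mul_of_nonneg_right _ (Nat.cast_nonneg _)
  have h2 : 2 / ε ≤ n := by
    have : (⌈2 / ε⌉₊ : ℝ) + 1 ≤ n := by exact_mod_cast hn
    linarith [Nat.le_ceil (2 / ε)]
  have : 2 / (n : ℝ) ≤ ε := by
    rw [div_le_iff₀ hn0]
    rw [div_le_iff₀ hε] at h2
    linarith
  linarith

end LowDensity

end Summit.PneNP.PneNP.Theorems
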